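import Summits.QuantumFields.YangMills.Theorems.UnitScaleTiltProp7PV3CDEAttainment
import HarnessLib

/-!
# Route `UnitScaleTilt`, crux K1 child «MinimiserStabilityRegPr» (stmt-QuantumFields-19200), skeleton birth_v8 5b4e8467… — ROW (C) SPLIT, EXISTENCE HALF:
# «A SMALL LANDAU-GAUGE CRITICAL `X` OVER A (14)-BACKGROUND EXISTS» ⇐ `stub_PV3A` ∧ ATTAINMENT, for (7)-data

Cell `ym3-torus`, width seat `ym-ust-19200-w2` (gen 0; owner 00:21:07Z «w2 next: stub_PV3C»).  YM₃ on T³ is a ladder rung (R3), not the Clay problem; nothing here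
is a claim about the crux, d = 4 or the mass gap.

WHY.  Companion of `Prop7PV3CUniqueness`: at the carrier's reading R2 the EXISTENCE half of [Balaban1985Variational] Prop. 6 («exactly one solution in (112)»,
registered `stub_PV3C`) follows from attainment of the infimum over print's regular fibre and Prop. 2's chart: the minimiser `U*` over (6)(ε₀), `ε₀ = O·L³B₃ε₁`,
is critical (R2), has an axial-gauge representative on its (4)-orbit ([Balaban1985RegularSpaces] (1.19), `Prop7ChartPrint.axialRepr_print_based_uniform`), and Prop. 2
(`T3SectALandauChart.Prop2NativeAt`) writes that representative as `(U₁U₀)^u` with `U₁ = e^{iX}`, `X` in the (19)-ball `B₁(ε₀ + L³ε₁) ≤ B₁(O+1)·L³B₃ε₁`, (20), (21)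
and «U₁ critical».  So, for (7)-data `V` (the datum of `Prop7From14At`'s binder; the registered text omits `PlaqSmall ε₁ V`), replacing row (C) by its uniqueness half
plus the attainment row loses nothing: (C)'s existence half is recovered here.

WHAT IS PROVED (sorry-free, no definition).  **`existsC_of_A_att`** — at the log-chart letters over based Sect. A letters `A` with the axial law `hSax`:
(A) ∧ `∃ B₃′ a₀′ a₁′ > 0, MinSixAttainedAt L a₀′ a₁′ B₃′` ⇒ `∃ B a > 0, ∀ i ε₁ ≤ a, ∀ V (7)-regular, ∀ U₀ (14), ∃ X` Hermitian traceless with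
`nMax19 U₀ X < B·L³B₃ε₁`, `A.AvgCond V U₀ X`, `A.IsLandau U₀ X`, `A.CritL V U₀ (e^{iX})`; and **`existsC_sPrint_of_A_att`** — the same over w1's names at `sPrint L T`.

HONEST SCOPE.  (A) and ATTAINMENT are hypotheses; (7) for `V` is an explicit hypothesis (print's datum always has it; (14) ⇒ (7) with a constant is
`Prop8IterPlaqSmall.plaqSmall_iter_T3` for `L ≥ 7` only).  Count-neutral helper toward stmt-QuantumFields-19200 (`--supports`), not a proof of any stub.

References: T. Bałaban, CMP 102 (1985) 277–309 [Balaban1985Variational] ((6)–(7) p.278, (14) p.280, (19)–(21) p.281, Prop. 2 p.281, Prop. 6 p.295, (112) p.294);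
CMP 99 (1985) 75–102 [Balaban1985RegularSpaces] ((1.19) p.79, Thm 2 p.83).
-/

noncomputable section

namespace Summit.QuantumFields.YangMills.Theorems.Prop7PV3CExistence


open Literature.MathematicalPhysics.QuantumFieldTheory.Balaban1983to89
open Literature.MathematicalPhysics.QuantumFieldTheory.Balaban1983to89.T3ContinuumYM3Torus
open Literature.MathematicalPhysics.QuantumFieldTheory.Balaban1983to89.T3UnitLawDensityEML (ℰp)
open Literature.MathematicalPhysics.QuantumFieldTheory.Balaban1983to89.T3DescentFibreTower
open Literature.MathematicalPhysics.QuantumFieldTheory.Balaban1983to89.T3ConstrainedMinimiser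
open Literature.MathematicalPhysics.QuantumFieldTheory.Balaban1983to89.T3TiltDescent
open Literature.MathematicalPhysics.QuantumFieldTheory.Balaban1983to89.T3PrintedRegularMinimiser
open Literature.MathematicalPhysics.QuantumFieldTheory.Balaban1983to89.T3PrintedRegularOrbits (descTransf gaugeAct_mem_regFibrePr_iff_of_trivial)
open B11 (VarProblemX LGData Prop2Printed Prop5Printed Prop6Printed)
open B11Prop7Assembly (Bridge ExistenceLeavesCap one_landau_of_props silent_restrictions eps2_ge_prop2 ineq122_le second_condition_auto)
open B7Prop1Explicit renaming Site → LSite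
open B7Prop2Explicit (C0 c2' C0_pos c2'_pos)
open B8Eq119TwistedAxial (InAx Restr129)
open B8Thm4TorusAt (torusLam)
open B15DeterminingSets (embIter)
open B10Eq27TorusAxialLog (pull unitsField toUField)
open B8Thm2SetupTorus (pullGauge toUGauge)
open T3Thm1Carrier
open T3Thm1CarrierNative (IsCritR2 Prop7From14At)
open T3SectALandauChart
open Summit.QuantumFields.YangMills.Theorems.Prop7ChartInjectivity (sameOrbit_of_eq_law)
open Summit.QuantumFields.YangMills.Theorems.Prop7AxialReprPrint (inj16_print_based)
open Summit.QuantumFields.YangMills.Theorems.Prop7ChartPrint (atMostOneCriticalOrbit_of_props_inj' gaugeFix_of_conditional_axialRepr' axialRepr_print_based_uniform)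
open Summit.QuantumFields.YangMills.Theorems.Prop7TPrint
open Summit.QuantumFields.YangMills.Theorems.Prop7SPrint
open Summit.QuantumFields.YangMills.Theorems.Prop7PV3CDELogChart (prop5Printed_logChart prop6Printed_logChart_iff eq_expHermField_of_in19 nMax19_lt_of_in19)
open Summit.QuantumFields.YangMills.Theorems.Prop7PV3CDEAttainment (atMostOneCriticalOrbit_of_A_C)
open Summit.QuantumFields.YangMills.Theorems.Prop7PV3CDEAtSPrint (prop2Printed_tPrintFam_iff)
open Literature.MathematicalPhysics.QuantumFieldTheory.Balaban1983to89.T3ExistSplit (MinSixAttainedAt)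
open Literature.MathematicalPhysics.QuantumFieldTheory.Balaban1983to89.T3UnitLawGaugeInvariance (gaugeAct_gaugeAct)
open NormedSpace

open scoped Matrix.Norms.L2Operator


variable {L : ℕ}

/-- **EXISTENCE HALF OF ROW (C) FROM (A) AND ATTAINMENT, FOR (7)-DATA**: with `O = max{1, B₃′/(L³B₃)}`, `ε₀ = O·L³B₃ε₁`, the minimiser over (6)(ε₀) given by
attainment is R2-critical, is moved to the axial gauge inside its (4)-orbit, and Prop. 2 supplies `u`, `U₁ = e^{iX}` with (19) at `ε₂ = B₁(ε₀ + L³ε₁) ≤ B₁(O+1)L³B₃ε₁`,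
(20), (21), «U₁ critical»; `a = min{a₁′, a₀′/(OL³B₃), e/(OL³B₃), c₁/(2·O·L³B₃)}` with `e` the axial-gauge threshold of `axialRepr_print_based_uniform`.
[cite: Balaban1985Variational, Prop. 6 p.295, Prop. 2 p.281, (19)-(21) p.281; Balaban1985RegularSpaces, (1.19) p.79] -/
theorem existsC_of_A_att (hL : 1 < L) (A : ResidFam L) {B₃ : ℝ} (hB₃ : 1 ≤ B₃)
    (hSax : ∀ (i : Idx L) (U₀ U : GaugeField (i.1.1.P i.1.2.2) 0 (Matrix.specialUnitaryGroup (Fin 2) ℂ)),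
      (A i).IsAxial U₀ U ↔
        InAx (i.1.1.P i.1.2.2).L (i.1.2.2 - i.1.2.1) (torusLam (i.1.2.2 - i.1.2.1))
          (pull (unitsField (toUField U₀)) (embIter (i.1.2.2 - i.1.2.1) (0 : Site (i.1.1.P i.1.2.2) (i.1.2.2 - i.1.2.1))))
          (pull (unitsField (toUField U)) (embIter (i.1.2.2 - i.1.2.1) (0 : Site (i.1.1.P i.1.2.2) (i.1.2.2 - i.1.2.1)))))
    (hA : ∃ B₁ c₁ : ℝ, 0 < B₁ ∧ 0 < c₁ ∧ Prop2Printed B₁ B₃ ((L : ℝ) ^ 3) c₁ (famLG3 L (tPrintFam A)))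
    (hATT : ∃ B₃' a₀' a₁' : ℝ, 0 < B₃' ∧ 0 < a₀' ∧ 0 < a₁' ∧ MinSixAttainedAt L a₀' a₁' B₃') :
    ∃ B a : ℝ, 0 < B ∧ 0 < a ∧ ∀ (i : Idx L) (ε₁ : ℝ), 0 < ε₁ → ε₁ ≤ a →
      ∀ (V : GaugeField (i.1.1.P i.1.2.1) 0 (Matrix.specialUnitaryGroup (Fin 2) ℂ)), PlaqSmall ε₁ V →
      ∀ (U₀ : GaugeField (i.1.1.P i.1.2.2) 0 (Matrix.specialUnitaryGroup (Fin 2) ℂ)),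
        RegPr i.1.1 i.1.2.1 i.1.2.2 ((L : ℝ) ^ 3 * B₃ * ε₁) U₀ → CloseAvg i.1.1 i.1.2.1 i.1.2.2 i.2.2.le ((L : ℝ) ^ 3 * ε₁) V U₀ →
        ∃ X : PBond (i.1.1.P i.1.2.2) 0 → Matrix (Fin 2) (Fin 2) ℂ,
          nMax19 i.1.1 i.1.2.1 i.1.2.2 U₀ X < B * (L : ℝ) ^ 3 * B₃ * ε₁ ∧
          (∀ b : PBond (i.1.1.P i.1.2.2) 0, (X b).IsHermitian ∧ Matrix.trace (X b) = 0) ∧ (A i).AvgCond V U₀ X ∧ (A i).IsLandau U₀ X ∧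
            (A i).CritL V U₀ (expHermField X) := by
  have hL1 : (1 : ℝ) ≤ (L : ℝ) := by exact_mod_cast hL.le
  have hC₁ : (1 : ℝ) ≤ (L : ℝ) ^ 3 := one_le_pow₀ hL1
  have hC₁pos : (0 : ℝ) < (L : ℝ) ^ 3 := by positivity
  have hC0 : 0 < C0 3 := C0_pos _
  have hc2 : 0 < c2' 3 L := c2'_pos _ _ hL.le
  set e : ℝ := min (1 / (6 * C0 3 * (L : ℝ) ^ 3)) (c2' 3 L / (4 * (L : ℝ) ^ 3)) with he_def
  have he : 0 < e := lt_min (by positivity) (by positivity)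
  obtain ⟨B₁, c₁, hB₁, hc₁, h2⟩ := hA
  have h2n : Prop2NativeAt L (tPrintFam A) B₁ B₃ ((L : ℝ) ^ 3) c₁ := prop2Printed_famLG3_iff_native.1 h2
  obtain ⟨B₃', a₀', a₁', hB₃', ha₀', ha₁', HATT⟩ := hATT
  have hK : 0 < (L : ℝ) ^ 3 * B₃ := by positivity
  set O : ℝ := max 1 (B₃' / ((L : ℝ) ^ 3 * B₃)) with hO
  have hO1 : 1 ≤ O := le_max_left _ _
  have hO0 : 0 < O := lt_of_lt_of_le one_pos hO1
  have hOK : 0 < O * ((L : ℝ) ^ 3 * B₃) := mul_pos hO0 hK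
  have hB₃'O : B₃' ≤ O * ((L : ℝ) ^ 3 * B₃) :=
    (div_le_iff₀ hK).1 (le_max_right 1 (B₃' / ((L : ℝ) ^ 3 * B₃)))
  refine ⟨B₁ * (O + 1), min (min a₁' (a₀' / (O * ((L : ℝ) ^ 3 * B₃)))) (min (e / (O * ((L : ℝ) ^ 3 * B₃))) (c₁ / (2 * (O * ((L : ℝ) ^ 3 * B₃))))),
    by positivity, lt_min (lt_min ha₁' (div_pos ha₀' hOK)) (lt_min (div_pos he hOK) (div_pos hc₁ (by positivity))), ?_⟩
  intro i ε₁ hε₁ hε₁a V hV U₀ hRU₀ hclose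
  obtain ⟨⟨F, n, K⟩, hF, hnK⟩ := i
  have ha₁ : ε₁ ≤ a₁' := hε₁a.trans ((min_le_left _ _).trans (min_le_left _ _))
  have ha₀ : ε₁ ≤ a₀' / (O * ((L : ℝ) ^ 3 * B₃)) := hε₁a.trans ((min_le_left _ _).trans (min_le_right _ _))
  have hae : ε₁ ≤ e / (O * ((L : ℝ) ^ 3 * B₃)) := hε₁a.trans ((min_le_right _ _).trans (min_le_left _ _))
  have hac : ε₁ ≤ c₁ / (2 * (O * ((L : ℝ) ^ 3 * B₃))) := hε₁a.trans ((min_le_right _ _).trans (min_le_right _ _))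
  -- the radius ε₀ = O·L³B₃ε₁ and its regime facts
  set ε₀ : ℝ := O * ((L : ℝ) ^ 3 * B₃) * ε₁ with hε₀def
  have hε₀pos : 0 < ε₀ := mul_pos hOK hε₁
  have hlo : B₃' * ε₁ ≤ ε₀ := mul_le_mul_of_nonneg_right hB₃'O hε₁.le
  have hhi : ε₀ ≤ a₀' := by
    have h1 := (le_div_iff₀ hOK).1 ha₀
    simp only [hε₀def]; linarith
  have hεe : ε₀ ≤ e := by
    have h1 := (le_div_iff₀ hOK).1 hae
    simp only [hε₀def]; linarith
  have hεe' : ε₀ ≤ min (1 / (6 * C0 3 * (L : ℝ) ^ 3)) (c2' 3 L / (4 * (L : ℝ) ^ 3)) := by rw [← he_def]; exact hεe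
  have hB₃ε : B₃ * ε₁ ≤ ε₀ := by
    have h1 : B₃ ≤ O * ((L : ℝ) ^ 3 * B₃) := by
      have hB₃0 : 0 ≤ B₃ := by linarith
      have : B₃ ≤ (L : ℝ) ^ 3 * B₃ := le_mul_of_one_le_left hB₃0 hC₁
      calc B₃ ≤ (L : ℝ) ^ 3 * B₃ := this
        _ ≤ O * ((L : ℝ) ^ 3 * B₃) := le_mul_of_one_le_left (by positivity) hO1
    exact mul_le_mul_of_nonneg_right h1 hε₁.le
  have hL3e : (L : ℝ) ^ 3 * ε₁ ≤ ε₀ := by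
    have h1 : (L : ℝ) ^ 3 ≤ O * ((L : ℝ) ^ 3 * B₃) := by
      have : (L : ℝ) ^ 3 ≤ (L : ℝ) ^ 3 * B₃ := le_mul_of_one_le_right hC₁pos.le hB₃
      exact this.trans (le_mul_of_one_le_left (by positivity) hO1)
    exact mul_le_mul_of_nonneg_right h1 hε₁.le
  have hsum : ε₀ + (L : ℝ) ^ 3 * ε₁ ≤ c₁ := by
    have h1 := (le_div_iff₀ (by positivity : (0 : ℝ) < 2 * (O * ((L : ℝ) ^ 3 * B₃)))).1 hac
    simp only [hε₀def]; nlinarith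
  -- attainment: the minimiser `U*` over (6)(ε₀); it is R2-critical
  obtain ⟨Us, hUs, hUsmin⟩ := HATT F hF n K hnK ε₁ ε₀ hε₁ ha₁ hlo hhi V hV
  have hUscrit : IsCritR2 F n K hnK.le V Us := T3Thm1CarrierNative.isCritR2_of_isMinOn hε₀pos hUs hUsmin
  -- the (14)-background hypothesis at the carrier
  have h14 : Sat14T3 F n K hnK.le ((L : ℝ) ^ 3 * B₃ * ε₁) ((L : ℝ) ^ 3 * ε₁) V U₀ := ⟨hRU₀, hclose⟩
  -- axial-gauge representative on the (4)-orbit of `U*`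
  obtain ⟨v, hv, hvAx⟩ := axialRepr_print_based_uniform F hF hnK.le hC₁ B₃ ε₀ ε₁ V U₀ Us hεe' hB₃ε h14 hUs
  have hWax : (tPrintFam A ⟨(F, n, K), hF, hnK⟩).IsAxial U₀ (GaugeField.gaugeAct v Us) := (hSax ⟨(F, n, K), hF, hnK⟩ U₀ _).2 (hvAx _)
  have hWmem : GaugeField.gaugeAct v Us ∈ regFibrePr F n K hnK.le ε₀ V :=
    (gaugeAct_mem_regFibrePr_iff_of_trivial F hnK.le hε₀pos.le hv Us V).mpr hUs
  have hWcrit : IsCritR2 F n K hnK.le V (GaugeField.gaugeAct v Us) := isCritR2_gaugeAct_of_trivial F hnK.le hv hUscrit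
  -- Prop. 2 at ε₂ = B₁(ε₀ + L³ε₁)
  obtain ⟨u, U₁, X, _hu, _hUeq, h19, h20, h21, hcL⟩ :=
    h2n F hF n K hnK ε₀ ε₁ (B₁ * (ε₀ + (L : ℝ) ^ 3 * ε₁)) hε₀pos hε₁ hsum le_rfl V U₀ hRU₀ hclose (GaugeField.gaugeAct v Us) hWmem hWax hWcrit
  have hε₂B : B₁ * (ε₀ + (L : ℝ) ^ 3 * ε₁) ≤ B₁ * (O + 1) * (L : ℝ) ^ 3 * B₃ * ε₁ := by
    have h1 : (L : ℝ) ^ 3 * ε₁ ≤ (L : ℝ) ^ 3 * B₃ * ε₁ := by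
      have := mul_le_mul_of_nonneg_right (le_mul_of_one_le_right hC₁pos.le hB₃) hε₁.le
      exact this
    have h2' : ε₀ + (L : ℝ) ^ 3 * ε₁ ≤ (O + 1) * (L : ℝ) ^ 3 * B₃ * ε₁ := by
      simp only [hε₀def]; nlinarith
    calc B₁ * (ε₀ + (L : ℝ) ^ 3 * ε₁) ≤ B₁ * ((O + 1) * (L : ℝ) ^ 3 * B₃ * ε₁) := mul_le_mul_of_nonneg_left h2' hB₁.le
      _ = B₁ * (O + 1) * (L : ℝ) ^ 3 * B₃ * ε₁ := by ring
  have e₁ : U₁ = expHermField X := eq_expHermField_of_in19 h19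
  refine ⟨X, nMax19_lt_of_in19 h19 hε₂B, h19.1, h20, h21, ?_⟩
  show (A ⟨(F, n, K), hF, hnK⟩).CritL V U₀ (expHermField X)
  rw [← e₁]; exact hcL

/-- **THE SAME OVER w1's NAMES AT `sPrint L T`** (`AvgCondPrint`, `IsLandauPrint`, `CritLPrint`; the axial law is `hSax_sPrint`).
[cite: Balaban1985Variational, Prop. 6 p.295, Prop. 2 p.281] -/
theorem existsC_sPrint_of_A_att (hL : 1 < L) (T : ResidFam L) {B₃ : ℝ} (hB₃ : 1 ≤ B₃)
    (hA : ∃ B₁ c₁ : ℝ, 0 < B₁ ∧ 0 < c₁ ∧ Prop2Printed B₁ B₃ ((L : ℝ) ^ 3) c₁ (famLG3 L (sPrint L T)))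
    (hATT : ∃ B₃' a₀' a₁' : ℝ, 0 < B₃' ∧ 0 < a₀' ∧ 0 < a₁' ∧ MinSixAttainedAt L a₀' a₁' B₃') :
    ∃ B a : ℝ, 0 < B ∧ 0 < a ∧ ∀ (i : Idx L) (ε₁ : ℝ), 0 < ε₁ → ε₁ ≤ a →
      ∀ (V : GaugeField (i.1.1.P i.1.2.1) 0 (Matrix.specialUnitaryGroup (Fin 2) ℂ)), PlaqSmall ε₁ V →
      ∀ (U₀ : GaugeField (i.1.1.P i.1.2.2) 0 (Matrix.specialUnitaryGroup (Fin 2) ℂ)),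
        RegPr i.1.1 i.1.2.1 i.1.2.2 ((L : ℝ) ^ 3 * B₃ * ε₁) U₀ → CloseAvg i.1.1 i.1.2.1 i.1.2.2 i.2.2.le ((L : ℝ) ^ 3 * ε₁) V U₀ →
        ∃ X : PBond (i.1.1.P i.1.2.2) 0 → Matrix (Fin 2) (Fin 2) ℂ,
          nMax19 i.1.1 i.1.2.1 i.1.2.2 U₀ X < B * (L : ℝ) ^ 3 * B₃ * ε₁ ∧
          (∀ b : PBond (i.1.1.P i.1.2.2) 0, (X b).IsHermitian ∧ Matrix.trace (X b) = 0) ∧ AvgCondPrint i.1.1 i.1.2.1 i.1.2.2 i.2.2.le V U₀ X ∧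
            IsLandauPrint i.1.1 i.1.2.1 i.1.2.2 U₀ X ∧ CritLPrint i.1.1 i.1.2.1 i.1.2.2 i.2.2.le V U₀ (expHermField X) := by
  have hA' : ∃ B₁ c₁ : ℝ, 0 < B₁ ∧ 0 < c₁ ∧ Prop2Printed B₁ B₃ ((L : ℝ) ^ 3) c₁ (famLG3 L (tPrintFam (sPrint L T))) := by
    obtain ⟨B₁, c₁, hB₁, hc₁, h2⟩ := hA
    exact ⟨B₁, c₁, hB₁, hc₁, (prop2Printed_tPrintFam_iff (sPrint L T)).2 h2⟩
  exact existsC_of_A_att hL (sPrint L T) hB₃ (hSax_sPrint T) hA' hATT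

end Summit.QuantumFields.YangMills.Theorems.Prop7PV3CExistence

end
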